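import Literature.AnabelianGeometry.EtaleTheta.FrobenioidMonoTheta
import Literature.AnabelianGeometry.EtaleTheta.Discharge.Sec5DegenerateDatum
import Literature.AnabelianGeometry.EtaleTheta.Discharge.Sec5AutAmple

/-!
# [EtTh] §5 as typed — Thm. 5.10 (ii) at the identity self-equivalence; closed MODEL-WITNESSES for FACT-LIST rows F-0541 / F-0542 / F-0543 / F-0737

Mochizuki, *The étale theta function and its Frobenioid-theoretic manifestations*, Publ. RIMS **45**
(2009), §5 pp.330–334 (PDF pp.104–108) [cite: MochizukiEtTh2009, §5 p.330 (PDF p.104)].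
Cell abc-iut, block F (fact-proving wave), seat abc-iut-f-122 (tranche 122).  PROOF-ONLY companion of
abc-iut-L2-t4's `FrobenioidMonoTheta.lean` (FROZEN; imported, never edited); no new `Prop` fact, no
definition.

CONTEXT.  The four tranche-122 rows are PREDICATES on `𝔉 : ThetaFrobenioid C D` (data-only §5
interface): F-0541 `PsiAutPreserves` (Thm. 5.10 (ii)), F-0542 `SectionsFactor` (Lem. 5.9 (i)), F-0543
`SgpCupSection` (p.331), F-0737 `AutAmpleBN` (p.330).  Their UNIVERSAL CLOSURES are already REFUTED in
the tree (abc-iut-f-112, `Discharge/Sec5MonoThetaUniversalClosureRefuted.lean`: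
`MonoThetaToy.not_forall_psiAutPreserves` / `…_sectionsFactor` / `…_sgpCupSection` / `…_autAmpleBN`).
This file adds the complementary SATISFIABILITY half of the R5 verdict («named instances only»):
* `ThetaFrobenioid.psiAutPreserves_refl` — for EVERY §5 datum `𝔉`, Thm. 5.10 (ii) as typed HOLDS for the
  identity self-equivalence `Ψ = 𝟭_C`, `β = 𝟙_{B_N}`, `Ψ^birat_Aut = id` (with `δ₁ = δ₂ = δ₃ = 1`): the
  typed statement is never vacuous, and its content lies entirely in the NAMED `Ψ` of Thm. 5.7 / Cor. 5.12;
* `Sec5Toy.sectionsFactor_datum`, `Sec5Toy.sgpCupSection_datum`, `Sec5Toy.autAmpleBN_datum`,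
  `Sec5Toy.psiAutPreserves_datum_refl` — the four rows HOLD at the closed degenerate §5 datum
  `Sec5Toy.datum` of `Discharge/Sec5DegenerateDatum.lean` (which satisfies the whole bundle `Facts`,
  `Sec5Toy.facts_datum`), via L2-t4's PROVED reductions `Facts.sectionsFactor`, `Facts.sgpCupSection` and
  `Facts.autAmpleBN_redundant` (`Discharge/Sec5AutAmple.lean`);
* `Sec5Toy.exists_tranche122_rows` — the existential companion, binder-for-binder, of f-112's four `¬ ∀`.
So each row reads «universal-closure REFUTED (p430173) / schema; instance form PROVED (conditional
closers `sectionsFactor_of`, `sgpCupSection_of`, `autAmpleBN_of_sgpCapSection`, `psiAutPreserves_of`) and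
MODEL-WITNESSED (this file)».  HONEST FRAMING: kernel statements about OUR typed interface; a toy or the
identity functor says nothing about the tempered Frobenioid of `Ÿ` or about [IUTchIII] Cor. 3.12; a FACT
row is an assumption label; no side taken; typed ≠ proved.
-/

namespace Literature.AnabelianGeometry.EtaleTheta

open CategoryTheory
open scoped Pointwise

universe w v v' u u'

namespace ThetaFrobenioid

variable {C : Type u} [Category.{v} C] {D : Type u'} [Category.{v'} D] (𝔉 : ThetaFrobenioid.{w} C D)

/-! ### `Ψ^Aut` for the identity self-equivalence is the identity of `Aut_C(B_N)` -/

/-- For `Ψ = 𝟭_C` and `β = 𝟙_{B_N}`, "the automorphism `Ψ^Aut` determined by applying `Ψ` followed by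
conjugation by `β`" (Thm. 5.10 (ii), p.333 (PDF p.107)) is the identity: `Ψ^Aut(a) = a`.
[cite: MochizukiEtTh2009, Thm 5.10 (ii) p.333 (PDF p.107)] -/
theorem psiAut_refl_apply (a : Aut 𝔉.BN) :
    𝔉.psiAut (CategoryTheory.Equivalence.refl (C := C)) (Iso.refl 𝔉.BN) a = a := by
  change (Iso.refl 𝔉.BN).conjAut ((𝟭 C).mapIso a) = a
  rw [Iso.conjAut_apply]
  exact Aut.ext (by simp)

/-- `Ψ^Aut = id` on `Aut_C(B_N)` for the identity self-equivalence (as a monoid homomorphism).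
[cite: MochizukiEtTh2009, Thm 5.10 (ii) p.333 (PDF p.107)] -/
theorem psiAut_refl :
    𝔉.psiAut (CategoryTheory.Equivalence.refl (C := C)) (Iso.refl 𝔉.BN) = MonoidHom.id (Aut 𝔉.BN) :=
  MonoidHom.ext 𝔉.psiAut_refl_apply

/-! ### F-0541 `PsiAutPreserves` HOLDS at the identity self-equivalence, for every §5 datum -/

/-- **F-0541 model-witness (every `𝔉`)**: [EtTh] Thm. 5.10 (ii) as typed (`PsiAutPreserves`) HOLDS for
`Ψ = 𝟭_C`, `β = 𝟙_{B_N}`, `Ψ^birat_Aut = id`: "`Ψ^Aut`, `Ψ^birat_Aut` preserve `O^×(B_N)`;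
`(O_K^×)^{1/N}`; `O^×(B_N^birat)`; `(K^×)^{1/N}` and map the data `E_N`; `Im(s^⊓-gp_N)`; `Im(s^⊔-gp_N)` to
`δ₁ · E_N · δ₁⁻¹`; …" with `δ₁ = δ₂ = δ₃ = 1` (`1 ∈ O^×(B_N)`, `1 ∈ μ_{2lN}(B_N) ∩ (O_K^×)^{1/N}`,
`1 = s^⊓-gp_N(1)`).  The typed predicate is therefore satisfiable at EVERY datum; its content lies in the
NAMED `Ψ` of Thm. 5.7 (`psiAutPreserves_of`, `psiAutPreserves_of_rootTransportWith`).
[cite: MochizukiEtTh2009, Thm 5.10 (ii) p.333–334 (PDF pp.107–108)] -/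
theorem psiAutPreserves_refl :
    𝔉.PsiAutPreserves (CategoryTheory.Equivalence.refl (C := C)) (Iso.refl 𝔉.BN) (MulEquiv.refl _) := by
  have hΨ := 𝔉.psiAut_refl
  refine ⟨?_, ?_, ?_, ?_, 1, 1, 1, one_mem _, ⟨one_mem _, one_mem _⟩, one_mem _, ?_, ?_, ?_⟩
  · rw [hΨ, Subgroup.map_id]
  · rw [hΨ, Subgroup.map_id]
  · intro u hu
    rw [MulEquiv.refl_apply]
    exact congrArg _ (Subtype.ext (𝔉.psiAut_refl_apply u).symm)
  · rw [MulEquiv.toMonoidHom_eq_coe, MulEquiv.coe_monoidHom_refl, Subgroup.map_id]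
  · rw [hΨ, Subgroup.map_id, map_one, one_smul]
  · rw [hΨ, Subgroup.map_id, map_one, one_smul]
  · rw [hΨ, Subgroup.map_id, mul_one, mul_one, map_one, one_smul]

end ThetaFrobenioid

/-! ### The four tranche-122 rows HOLD at the closed degenerate §5 datum `Sec5Toy.datum` -/

namespace Sec5Toy

open ThetaFrobenioid

/-- **F-0542 model-witness**: Lem. 5.9 (i) as typed, "`s^⊓-gp_N|_{H_{B_N}}`, `s^⊔-gp_N` factor through
`E_N`", HOLDS at `Sec5Toy.datum` (from `Facts.sectionsFactor` and `facts_datum`).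
[cite: MochizukiEtTh2009, Lem 5.9 (i) p.331 (PDF p.105)] -/
theorem sectionsFactor_datum : datum.SectionsFactor :=
  facts_datum.sectionsFactor

/-- **F-0543 model-witness**: "`(s^⊔-gp_N(h))^bs = h`" (p.331) as typed HOLDS at `Sec5Toy.datum`
(from `Facts.sgpCupSection` and `facts_datum`). [cite: MochizukiEtTh2009, §5 p.331 (PDF p.105)] -/
theorem sgpCupSection_datum : datum.SgpCupSection :=
  facts_datum.sgpCupSection

/-- **F-0737 model-witness**: "`B_N` is Aut-ample" (p.330 (PDF p.104)) as typed HOLDS at `Sec5Toy.datum`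
(from `Facts.autAmpleBN_redundant` — the field is REDUNDANT given `SgpCapSpec` + `StrvSection` — and
`facts_datum`). [cite: MochizukiEtTh2009, §5 p.330 (PDF p.104)] -/
theorem autAmpleBN_datum : datum.AutAmpleBN :=
  facts_datum.autAmpleBN_redundant

/-- **F-0541 model-witness (closed datum)**: Thm. 5.10 (ii) as typed HOLDS at `Sec5Toy.datum` for the
identity self-equivalence. [cite: MochizukiEtTh2009, Thm 5.10 (ii) p.333 (PDF p.107)] -/
theorem psiAutPreserves_datum_refl :
    datum.PsiAutPreserves (CategoryTheory.Equivalence.refl (C := Discrete PUnit.{1})) (Iso.refl datum.BN)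
      (MulEquiv.refl _) :=
  datum.psiAutPreserves_refl

/-- **Existential companion of f-112's four `¬ ∀`** (same binders, universe `0`): there is a closed §5
datum at which `SectionsFactor`, `SgpCupSection`, `AutAmpleBN` hold and `PsiAutPreserves` holds for the
identity self-equivalence — so F-0541 / F-0542 / F-0543 / F-0737 are SCHEMATA that are neither provable
(p430173) nor refutable (this theorem) over the bare interface: hypotheses on the NAMED §5 data.
[cite: MochizukiEtTh2009, §5 p.330 (PDF p.104)] -/
theorem exists_tranche122_rows :
    ∃ (C : Type) (_ : Category.{0} C) (D : Type) (_ : Category.{0} D) (𝔉 : ThetaFrobenioid.{0} C D),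
      𝔉.SectionsFactor ∧ 𝔉.SgpCupSection ∧ 𝔉.AutAmpleBN ∧
        𝔉.PsiAutPreserves (CategoryTheory.Equivalence.refl (C := C)) (Iso.refl 𝔉.BN) (MulEquiv.refl _) :=
  ⟨_, _, _, _, datum, sectionsFactor_datum, sgpCupSection_datum, autAmpleBN_datum,
    psiAutPreserves_datum_refl⟩

end Sec5Toy

end Literature.AnabelianGeometry.EtaleTheta
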